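/-
Copyright (c) 2026 the pub-hodgecm-mathlib formalisation cell (harness21).  Prover seat hodgecm-mathlib-LH7-p05 (g0), req620 Track A «(D-RAM) FOUR-FRAME» squad, helper lane on
h413 = stmt-HodgeConjecture-24833 (count-neutral).  β-BOARD row R8-EQ-b «H(ρ) ABOVE THE LOCUS ON THE EQUILATERAL KEY» (β chair F0P3a-p01 (g37) LEDGER #17), FILE EQ-1.  2026-09-04.
-/
import Summits.HodgeConjecture.HodgeConjecture.Theorems.F0P3cDyRamLabelledOddCoreHangingShell   -- ★ p861362 (LH7-p08 (g0)) FILE 1: `latticeInLevel_diag_latt_H_iff`; brings ★ B7 `stratum_H_eq`, ★ DEFS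
import HarnessLib

/-!
# Crux `H413`, line LH4 «(D-RAM) FOUR-FRAME» — (β) table, β-BOARD row R8-EQ (THE EQUILATERAL KEY `n₁ = n₂ = n₃ = m`), FILE EQ-1: OFF THE WINDOW THE CLEAN-SHELL CUT OF THE
# CORE-HANGING STRATUM `H(ρ) = (2ρ, 2ρ, 2ρ)` IS EMPTY — below the locus (`2ρ + ℓ₀ < m`) and in the top range (`2m < 2ρ + mcOfRecord d`) the labelled-odd table is `0`, token-free

Cell `hodgecm-mathlib` (D-0151), FLOOR 0, crux item H413 = `stmt-HodgeConjecture-24833`, route `HCCMUnconditional`; squad F0∕P3c∕LH4 (β-table fan; β chair F0P3a-p01 (g37), H-line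
junction LH4-p05 (g9)).  THEOREMS ONLY (no `def`, no instance, no notation, no `sorry`, default heartbeats); ★-only imports; lane `--supports stmt-HodgeConjecture-24833 --as helper`
(count-neutral); pays NO row, states NO law.  Consumer: the `hEQ` binder of LH4-p05 (g9)'s H-line junction `hangingValue_of_rows` (chair LEDGER #17:
`n₁ = n₂ → n₂ = n₃ → ∀ ρ, 1 ≤ ρ → 2ρ ≤ n₁+n₂+n₃ → ∀ i, v_i(H ρ) = 0`), together with R8-EQ-a (the locus stratum `2ρ + ℓ₀ = m`, LH7-p08 (g0)) and FILE EQ-2 (the window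
`m − ℓ₀ + 1 ≤ 2ρ ≤ 2m − mc`, this seat).

THE MATHEMATICS (LH7-p08's H-ROW DERIVATION v1 §1; chair's read, LEDGER #17).  ★ B7 `stratum_H_eq` writes `M ∈ H(ρ)` as `latt(1 0 0; x ϖ^ρ 0; xζ+y″ ϖ^ρζ ϖ^{2ρ})` with
`|x| = |ζ| = |y″| = |xζ + y″| = 1`; ★ p861362 `latticeInLevel_diag_latt_H_iff` reads `diag(a, b, 0)·M ⊆ ϖ^ℓ M ↔ |a|,|b| ≤ |ϖ|^ℓ ∧ |b − a| ≤ |ϖ|^{ℓ+ρ} ∧ |b| ≤ |ϖ|^{ℓ+ρ} ∧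
|xζ·b + a·y″| ≤ |ϖ|^{ℓ+2ρ}`.  On the EQUILATERAL key `|a| = |b| = |b − a| = |ϖ|^m` (`a = α − 1`, `b = β − 1`):
* §1 BELOW THE LOCUS (`2ρ + ℓ₀ + 1 ≤ m`): every letter of level `ℓ₀ + 1` holds (the mixed one because `|xζ·b + a·y″| ≤ |ϖ|^m`), so no member is on the clean shell;
* §1 TOP RANGE (`2m < 2ρ + mc`, `m ≥ mc` from `mc ≤ N₀`): a member on the shell has `ρ + ℓ₀ ≤ m` and `|xζ·b + a·y″| ≤ |ϖ|^{ℓ₀+2ρ}` with `ℓ₀ + 2ρ > m`; then the mixed letter of the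
  SQUARE token, `xζ·b² + a²·y″ = b·(xζ·b + a·y″) + a·(a − b)·y″`, has the two DISTINCT valuations `≥ m + ℓ₀ + 2ρ > 2m` and `= 2m`, hence valuation exactly
  `2m`, and the token `≤ |ϖ|^{mc+2ρ}` fails since `2m < mc + 2ρ`: no member is on the clean shell either.
* §2 the two labelled-odd zeros in ★ p861362's COMMON SHAPE for the H axis (`stratum σ ϖ T ![2ρ, 2ρ, 2ρ]`, ANY `T`), binders `(h12 : n₁ = n₂) (h23 : n₂ = n₃)`.
The WINDOW `m − ℓ₀ + 1 ≤ 2ρ ≤ 2m − mc` (cut = the thin class `|y″∕(xζ) + (β−1)∕(α−1)| = |ϖ|^{2ρ+ℓ₀−m}`; value `0` by the R7 linearisation at `t′ = 0`) is FILE EQ-2.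
HONEST LABEL: count-neutral; R8-EQ ∕ hH ∕ hRest ∕ (β-BAL) ∕ (β) ∕ T₊ OPEN; `HC_CM` is proved only modulo the 7 printed citations (2 remaining named inputs: hLiu418 =
`stmt-HodgeConjecture-24832`, h413 = `stmt-HodgeConjecture-24833`) until rung 0 closes.
References: [Kottwitz1986BaseChangeUnits] §1 pp. 240–241 · [Rogawski1990] §4.9 Prop. 4.9.1 (a)(b) p. 55 · [Serre1980Trees] Ch. II §1.1.
-/

set_option autoImplicit false

noncomputable section

namespace Summit.HodgeConjecture.HodgeConjecture.Cruxes.H413.F0P3cDyRamLabelledOddCoreHangingEquilateralOffWindow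

open Matrix WithZero
open Literature.NumberTheory.Automorphic Literature.NumberTheory.Automorphic.HermitianLattice
open Literature.NumberTheory.Automorphic.UnitaryLatticeTree Literature.NumberTheory.Automorphic.UnitaryThreeFourFrame
open Literature.NumberTheory.LocalFields Literature.NumberTheory.LocalFields.WildQuadraticDatum
open Summit.HodgeConjecture.HodgeConjecture.Cruxes.H413.F0P3cDyRamDiagonalTorusDefs
open Summit.HodgeConjecture.HodgeConjecture.Cruxes.H413.F0P3cDyRamDiagonalStrataDefs
open Summit.HodgeConjecture.HodgeConjecture.Cruxes.H413.F0P3cDyRamFourFrameCensusDefs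
open Summit.HodgeConjecture.HodgeConjecture.Cruxes.H413.F0P3cDyRamFourFramePieces (mstarOfRecord)
open Summit.HodgeConjecture.HodgeConjecture.Cruxes.H413.F0P3cDyRamStageOneBDefs
open Summit.HodgeConjecture.HodgeConjecture.Cruxes.H413.F0P3cDyRamLabelledOddCountDefs
open Summit.HodgeConjecture.HodgeConjecture.Cruxes.H413.F0P3cDyRamDiagonalCoreHangingSocket (stratum_H_eq)
open Summit.HodgeConjecture.HodgeConjecture.Cruxes.H413.F0P3cDyRamLabelledOddCoreHangingShell (latticeInLevel_diag_latt_H_iff)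
open scoped Valued WithZero Matrix MatrixGroups

variable {K : Type} [Field K] [Valued K ℤᵐ⁰] {σ : K →+* K} {ϖ : K} {d t : ℕ} {α β : K} {N₀ n₁ n₂ n₃ : ℕ}

/-! ## §1  Off the window no member of `H(ρ)` is on the clean shell (equilateral key) -/

/-- **EQUILATERAL KEY, OFF THE WINDOW: NO MEMBER OF `H(ρ) = (2ρ, 2ρ, 2ρ)` IS ON THE CLEAN SHELL** (token-free).  `n₁ = n₂ = n₃ = m`; either BELOW the locus (`2ρ + ℓ₀ < m`: the
`X`-level is at least `ℓ₀ + 1`) or in the TOP range (`2m < 2ρ + mcOfRecord d`: the square token fails — its mixed letter `b·MIX + a(a−b)y″` has valuation exactly `2m`).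
[cite: Kottwitz1986BaseChangeUnits, §1 pp. 240–241] [cite: Serre1980Trees, Ch. II §1.1] -/
theorem not_shell_of_mem_stratum_H_equilateral_offWindow (hD : IsRamifiedQuadraticDatum σ ϖ d t) (hE : IsElementDatum σ ϖ N₀ α β n₁ n₂ n₃)
    (hmc : mcOfRecord d ≤ N₀) (T : GL (Fin 3) K) {ρ : ℕ} (hρ : 1 ≤ ρ) (h12 : n₁ = n₂) (h23 : n₂ = n₃)
    (hoff : 2 * ρ + d % 2 < n₂ ∨ 2 * n₂ < 2 * ρ + mcOfRecord d) :
    ∀ M ∈ stratum σ ϖ T ![2 * ρ, 2 * ρ, 2 * ρ],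
      ¬ (LatticeInLevel ϖ (d % 2) (Matrix.diagonal ![α - 1, β - 1, 0]) M ∧ ¬ LatticeInLevel ϖ (d % 2 + 1) (Matrix.diagonal ![α - 1, β - 1, 0]) M ∧
          LatticeInLevel ϖ (mcOfRecord d) (Matrix.diagonal ![(α - 1) * (α - 1), (β - 1) * (β - 1), 0]) M) := by
  classical
  obtain ⟨-, hvσ, hϖ, hfix, -, -, -⟩ := id hD
  have hϖ0 : ϖ ≠ 0 := fun h0 => by rw [h0, map_zero] at hϖ; exact WithZero.coe_ne_zero hϖ.symm
  have hpw : ∀ p r : ℕ, Valued.v ϖ ^ p ≤ Valued.v ϖ ^ r ↔ r ≤ p := fun p r => by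
    rw [v_varpi_pow hϖ, v_varpi_pow hϖ, exp_le_exp]; omega
  have hpwlt : ∀ p r : ℕ, Valued.v ϖ ^ p < Valued.v ϖ ^ r ↔ r < p := fun p r => by
    rw [v_varpi_pow hϖ, v_varpi_pow hϖ, exp_lt_exp]; omega
  have hn₂ : N₀ ≤ n₂ := hE.2.2.2.2.2.2.2.2.2.1
  have hα : Valued.v (α - 1) = Valued.v ϖ ^ n₂ := hE.2.2.2.2.2.2.1
  have hβ : Valued.v (β - 1) = Valued.v ϖ ^ n₂ := h12 ▸ hE.2.2.2.2.2.1
  have hγ : Valued.v (β - 1 - (α - 1)) = Valued.v ϖ ^ n₂ := by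
    rw [show β - 1 - (α - 1) = -(α - β) by ring, Valuation.map_neg, h23]; exact hE.2.2.2.2.2.2.2.1
  intro M hM
  rw [stratum_H_eq hvσ hfix hϖ T hρ] at hM
  obtain ⟨-, -, x, ζ, y'', hx, hζ, hy, hxy, rfl⟩ := hM
  have hmixle : Valued.v (x * ζ * (β - 1) + (α - 1) * y'') ≤ Valued.v ϖ ^ n₂ := by
    refine (Valuation.map_add _ _ _).trans (max_le ?_ ?_)
    · rw [map_mul, map_mul, hx, hζ, one_mul, one_mul, hβ]
    · rw [map_mul, hα, hy, mul_one]
  rintro ⟨hlev, hnlev, hsq⟩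
  rcases hoff with hbelow | htop
  · -- BELOW THE LOCUS: level `ℓ₀ + 1` holds
    refine hnlev ((latticeInLevel_diag_latt_H_iff hϖ0 (d % 2 + 1) ρ (α - 1) (β - 1) hx hζ y'').2 ⟨⟨?_, ?_⟩, ?_, ?_, ?_⟩)
    · rw [hα, hpw]; omega
    · rw [hβ, hpw]; omega
    · rw [hγ, hpw]; omega
    · rw [hβ, hpw]; omega
    · exact hmixle.trans ((hpw _ _).2 (by omega))
  · -- TOP RANGE: the square token fails
    obtain ⟨-, hba, -, hmix⟩ := (latticeInLevel_diag_latt_H_iff hϖ0 (d % 2) ρ (α - 1) (β - 1) hx hζ y'').1 hlev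
    rw [hγ, hpw] at hba
    have hmcdef : mcOfRecord d = 2 * ((d % 2 + 2 * d - 1 + d) / 2) := rfl
    obtain ⟨-, -, -, hsqmix⟩ := (latticeInLevel_diag_latt_H_iff hϖ0 (mcOfRecord d) ρ ((α - 1) * (α - 1)) ((β - 1) * (β - 1)) hx hζ y'').1 hsq
    have hid : x * ζ * ((β - 1) * (β - 1)) + (α - 1) * (α - 1) * y'' =
        (β - 1) * (x * ζ * (β - 1) + (α - 1) * y'') + (α - 1) * ((α - 1) - (β - 1)) * y'' := by ring
    have h2 : Valued.v ((α - 1) * ((α - 1) - (β - 1)) * y'') = Valued.v ϖ ^ (2 * n₂) := by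
      rw [map_mul, map_mul, hα, hy, mul_one, show (α - 1) - (β - 1) = -(β - 1 - (α - 1)) by ring, Valuation.map_neg, hγ, ← pow_add, two_mul]
    have h1 : Valued.v ((β - 1) * (x * ζ * (β - 1) + (α - 1) * y'')) < Valued.v ((α - 1) * ((α - 1) - (β - 1)) * y'') := by
      rw [h2, map_mul, hβ]
      calc Valued.v ϖ ^ n₂ * Valued.v (x * ζ * (β - 1) + (α - 1) * y'') ≤ Valued.v ϖ ^ n₂ * Valued.v ϖ ^ (d % 2 + 2 * ρ) := by gcongr
        _ = Valued.v ϖ ^ (n₂ + (d % 2 + 2 * ρ)) := (pow_add _ _ _).symm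
        _ < Valued.v ϖ ^ (2 * n₂) := (hpwlt _ _).2 (by omega)
    rw [hid, Valuation.map_add_eq_of_lt_right _ h1, h2, hpw] at hsqmix
    omega

/-! ## §2  The two labelled-odd zeros in the common shape -/

/-- **R8-EQ, BELOW THE LOCUS: `H(ρ)` CARRIES LABELLED ODD VALUE `0` ON THE EQUILATERAL KEY** (`n₁ = n₂ = n₃`, `2ρ + ℓ₀ < n₂`; empty cut, token-free, any `T`).
[cite: Kottwitz1986BaseChangeUnits, §1 pp. 240–241] [cite: Rogawski1990, §4.9 Prop. 4.9.1 (a)(b) p. 55] -/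
theorem finsum_stratum_H_shell_labelledOdd_div_relIndex_eq_zero_of_equilateral_below (hD : IsRamifiedQuadraticDatum σ ϖ d t)
    (hE : IsElementDatum σ ϖ N₀ α β n₁ n₂ n₃) (hmc : mcOfRecord d ≤ N₀) (T : GL (Fin 3) K) (ρ : ℕ) (hρ : 1 ≤ ρ)
    (h12 : n₁ = n₂) (h23 : n₂ = n₃) (hbelow : 2 * ρ + d % 2 < n₂) (i : Fin 3) :
    ∑ᶠ M ∈ {M : Submodule 𝒪[K] (Fin 3 → K) | M ∈ stratum σ ϖ T ![2 * ρ, 2 * ρ, 2 * ρ] ∧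
        (LatticeInLevel ϖ (d % 2) (Matrix.diagonal ![α - 1, β - 1, 0]) M ∧ ¬ LatticeInLevel ϖ (d % 2 + 1) (Matrix.diagonal ![α - 1, β - 1, 0]) M ∧
          LatticeInLevel ϖ (mcOfRecord d) (Matrix.diagonal ![(α - 1) * (α - 1), (β - 1) * (β - 1), 0]) M)},
      (labelledOddCount σ ϖ 0 i (valueClassLabel σ ϖ (α - 1) (β - 1) (mstarOfRecord d) d) M : ℚ) /
        ((((unitStabilizer M).map (unitNormMap σ 3)).relIndex (fixedUnitTorus σ 3) : ℕ) : ℚ) = 0 := by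
  have hempty : {M : Submodule 𝒪[K] (Fin 3 → K) | M ∈ stratum σ ϖ T ![2 * ρ, 2 * ρ, 2 * ρ] ∧
        (LatticeInLevel ϖ (d % 2) (Matrix.diagonal ![α - 1, β - 1, 0]) M ∧ ¬ LatticeInLevel ϖ (d % 2 + 1) (Matrix.diagonal ![α - 1, β - 1, 0]) M ∧
          LatticeInLevel ϖ (mcOfRecord d) (Matrix.diagonal ![(α - 1) * (α - 1), (β - 1) * (β - 1), 0]) M)} = ∅ :=
    Set.eq_empty_of_forall_notMem fun M hM =>
      not_shell_of_mem_stratum_H_equilateral_offWindow hD hE hmc T hρ h12 h23 (Or.inl hbelow) M hM.1 hM.2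
  rw [hempty, finsum_mem_empty]

/-- **R8-EQ, TOP RANGE: `H(ρ)` CARRIES LABELLED ODD VALUE `0` ON THE EQUILATERAL KEY** (`n₁ = n₂ = n₃`, `2·n₂ < 2ρ + mcOfRecord d` — the square token fails; includes every
`ρ > n₂ − ℓ₀`; empty cut, token-free, any `T`). [cite: Kottwitz1986BaseChangeUnits, §1 pp. 240–241] [cite: Rogawski1990, §4.9 Prop. 4.9.1 (a)(b) p. 55] -/
theorem finsum_stratum_H_shell_labelledOdd_div_relIndex_eq_zero_of_equilateral_top (hD : IsRamifiedQuadraticDatum σ ϖ d t)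
    (hE : IsElementDatum σ ϖ N₀ α β n₁ n₂ n₃) (hmc : mcOfRecord d ≤ N₀) (T : GL (Fin 3) K) (ρ : ℕ) (hρ : 1 ≤ ρ)
    (h12 : n₁ = n₂) (h23 : n₂ = n₃) (htop : 2 * n₂ < 2 * ρ + mcOfRecord d) (i : Fin 3) :
    ∑ᶠ M ∈ {M : Submodule 𝒪[K] (Fin 3 → K) | M ∈ stratum σ ϖ T ![2 * ρ, 2 * ρ, 2 * ρ] ∧
        (LatticeInLevel ϖ (d % 2) (Matrix.diagonal ![α - 1, β - 1, 0]) M ∧ ¬ LatticeInLevel ϖ (d % 2 + 1) (Matrix.diagonal ![α - 1, β - 1, 0]) M ∧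
          LatticeInLevel ϖ (mcOfRecord d) (Matrix.diagonal ![(α - 1) * (α - 1), (β - 1) * (β - 1), 0]) M)},
      (labelledOddCount σ ϖ 0 i (valueClassLabel σ ϖ (α - 1) (β - 1) (mstarOfRecord d) d) M : ℚ) /
        ((((unitStabilizer M).map (unitNormMap σ 3)).relIndex (fixedUnitTorus σ 3) : ℕ) : ℚ) = 0 := by
  have hempty : {M : Submodule 𝒪[K] (Fin 3 → K) | M ∈ stratum σ ϖ T ![2 * ρ, 2 * ρ, 2 * ρ] ∧
        (LatticeInLevel ϖ (d % 2) (Matrix.diagonal ![α - 1, β - 1, 0]) M ∧ ¬ LatticeInLevel ϖ (d % 2 + 1) (Matrix.diagonal ![α - 1, β - 1, 0]) M ∧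
          LatticeInLevel ϖ (mcOfRecord d) (Matrix.diagonal ![(α - 1) * (α - 1), (β - 1) * (β - 1), 0]) M)} = ∅ :=
    Set.eq_empty_of_forall_notMem fun M hM =>
      not_shell_of_mem_stratum_H_equilateral_offWindow hD hE hmc T hρ h12 h23 (Or.inr htop) M hM.1 hM.2
  rw [hempty, finsum_mem_empty]

end Summit.HodgeConjecture.HodgeConjecture.Cruxes.H413.F0P3cDyRamLabelledOddCoreHangingEquilateralOffWindow

end
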